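/-
Copyright: lit-balaban Phase-2 proof seat p30 (gen 29).  Statement-level skeleton of a published paper; no proof claims beyond what
the kernel checks below.
-/
import Literature.MathematicalPhysics.QuantumFieldTheory.BalabanImbrieJaffe1984to88.BIJ88NeumannPropagatorSmallFieldCloseCubeTorus

/-!
# [BalabanImbrieJaffe1985] §7.3 p. 326 ⟵ [Balaban1983RegularityDecay] Theorem p. 573, (1.11)–(1.12): **THE `δG_k(□, Ω)` VALUE AND
# COVARIANT-DERIVATIVE MEMBERS AT SMALL NON-FLAT `U(1)` FIELDS WITHOUT THE DEEP-ROW RESTRICTION** — the value member at EVERY row `x ∈ □`,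
# the covariant-derivative member at every row whose open `L^k`-ball lies in `□`; nested `k`-block unions with the (H1.10″) members as
# hypotheses, and the hypothesis-free (torus cube, whole torus) instances («for rectangular parallelepipeds … for all x, x′ ∈ Ω», p. 573)

T. Bałaban, J. Imbrie, A. Jaffe, *Renormalization of the Higgs model: minimizers, propagators and the stability of mean field theory*,
Commun. Math. Phys. **97** (1985) 299–329 [BalabanImbrieJaffe1985], row **C1.Eq7.3.1-7.3.2** (owner r15) / front **C2S14** (owner r18: the
`(H1.12)` closeness input of p31's `(2.31)_k ⟸ (1.10)–(1.12)` chain at plaquette-small non-flat fields, rows C2.Eq2.31 / C2.Claim@263);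
[7] = T. Bałaban, *Regularity and decay of lattice Green's functions*, Commun. Math. Phys. **89** (1983) 571–597 [Balaban1983RegularityDecay].

statement-level skeleton of published theorems with citation tags; proofs where landed; nothing here is a claim about the Yang–Mills mass gap

PDF held and re-read this session: `paper:balaban1983-cmp89-regularity-decay` p. 573 = PDF 3, the Theorem, lines 12–24: *"Theorem
(Proposition 2.1 of [1]). For α < 1 there exist positive constants δ₀, c₀, R₀ independent of A, k, Ω and depending on d, M only, c₀ on α
also, such that for e sufficiently small and for an arbitrary function f : Ω → R^N, we have (1.9) … for x, x′ ∈ Ω, and satisfying the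
condition dist({x, x′}, Ω^c) ≥ R₀. Similarly |(D^η_{A,μ}G_k(Ω,A)f)(x)|, |(G_k(Ω,A)f)(x)| ≤ c₀exp(−δ₀dist(x, supp f))‖f‖_∞ (1.10) for x ∈ Ω,
dist(x, Ω^c) ≥ R₀. If Ω ⊂ Ω₀, then for δG_k(Ω,Ω₀,A) defined by the equality δG_k(Ω,Ω₀,A) = G_k(Ω,A) − G_k(Ω₀,A), (1.11) we have the
inequalities (1.5) and (1.6) (with the same restrictions on x, x′) with the additional factor (1.12) on the right hand sides. For some
simple sets Ω, e.g. for rectangular parallelepipeds, the inequalities hold without any restrictions on the points x, x′, i.e. for all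
x, x′ ∈ Ω."*; `paper:balaban1985-cmp97-bij-higgs-minimizers` p. 326 = PDF 28, lines 18–22: *"The propagators arising from Δ_k(u_k), under
the restriction (7.3.1) on the gauge field, also satisfy the regularity and decay estimates of [7]."*

WHAT THIS FILE PROVES (objects: p31's region Neumann propagators `G_k(X,u) = gBox (α_kL^{kd}) ε⁻¹ u k X` on the fine torus, `X` a union of
`k`-blocks (`IsBlockUnion`), `T(x,y) = |x − y|_∞` the sup torus distance in fine units = `B5Ineq137Torus.T P 0`).  Gen 27's
`BIJ88NeumannPropagatorSmallFieldClose.close112_smallField_of_inputs` and gen 28's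
`BIJ88NeumannPropagatorSmallFieldCloseDeriv.close112_smallField_deriv_of_inputs` carry OUR row restrictions `dist_∞(x, T ∖ □) ≥ 10L^k`,
resp. `≥ 14L^k` (the print's *"dist(x, Ω^c) ≥ R₀"* with our `R₀`).  On the remaining rows the two (H1.10″) members ALONE already give the
(1.11)–(1.12) bound — the factor `e^{−δ dist(x, □^c)/L^k}` is `≥ e^{−R₀δ}` there and `dist(supp f, □^c) ≤ dist(x, supp f) + dist(x, □^c)` —
so the restriction can be dropped at the cost of the constants:
* §2 **`close112_smallField_of_inputs_allRows`** — gen 27's theorem VERBATIM with the hypothesis `(∀ w ∉ □, 10L^k ≤ T x w)` deleted: for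
  `2 ≤ d ≤ 3`, `L` odd `> 1`, `a > 0`, `c₀ ≥ 0`, `δ₀ > 0` there are `c₁, δ₁ > 0` such that for every volume, `1 ≤ k ≤ K`, every `U(1)` field
  with `|u(∂p) − 1| ≤ θ`, `2d³(L^{2k}θ)² ≤ 1`, all nested `k`-block unions `□ ⊆ Ω` carrying the two (H1.10″) value members `(c₀, δ₀)` on the
  `□`-rows, EVERY `x ∈ □` and every `f` supported in `□` (`‖f‖_∞ ≤ F`, `D ≤ dist(x, supp f)`, `D_b ≤ dist(x, □^c)`, `D_f ≤ dist(supp f, □^c)`):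
  `‖(G_k(□,u)f)(x) − (G_k(Ω,u)f)(x)‖ ≤ (L^kε)²·c₁e^{−δ₁D/L^k}e^{−δ₁(D_b + D_f)/L^k}·F`
  (`(c₁, δ₁) = (max(c₁⁽²⁷⁾, 2c₀e^{10δ₀}), min(δ₁⁽²⁷⁾, δ₀/2))`);
* §3 **`close112_smallField_deriv_of_inputs_ballRows`** — gen 28's theorem VERBATIM with the row hypothesis `14L^k ≤ T x w` weakened to
  `L^k ≤ T x w` (every `w ∉ □`) = exactly the rows on which the (H1.10″)-`D` binders `hDB`/`hDΩ` are stated (`{T(x,·) < L^k} ⊆ □`):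
  `‖covD ε⁻¹ u (G_k(□,u)f)⟨x,μ⟩ − covD ε⁻¹ u (G_k(Ω,u)f)⟨x,μ⟩‖ ≤ (L^kε)·c₂e^{−δ₂D/L^k}e^{−δ₂(D_b + D_f)/L^k}·F`;
* §4 **`close112_smallField_hC_allRows`** — the hypothesis `hC` of p31's `BIJ88DeltaLocClose235General.opClose231_gen` for a family of
  `k`-block unions `□_α ⊆ Ω` with the row sets `X_α := □_α` (ALL rows; gen 27's `close112_smallField_hC` wanted `X_α ⊆ {depth ≥ 10L^k}`);
* §5 the HYPOTHESIS-FREE instances for (□, Ω) = (torus cube `cubeT (L^k) c (L^kM)`, whole torus) under `((L^k)²θ)² ≤ 1/500` ALONE —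
  **`close112_smallPlaquette_cube_torus_allRows`** (value member, EVERY `x ∈ □`: the p. 573 sentence *"for rectangular parallelepipeds
  … for all x, x′ ∈ Ω"* for the value member of (1.11)–(1.12)) and **`close112_smallPlaquette_cube_torus_deriv_ballRows`** (covariant
  derivative, rows with `dist_∞(x, T ∖ □) ≥ L^k`, every `μ`), the four (H1.10″) inputs BY NAME exactly as in gen 28's
  `BIJ88NeumannPropagatorSmallFieldCloseCubeTorus`: p27's `decay110_smallField_input` / `decay110_smallPlaquette_cube_uniform` (values),
  gen 25's `decay110_smallField_deriv` and p34's `decay110_smallPlaquette_cube_deriv_uniform_input` (covariant derivatives).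

METHOD (ours; elementary given gens 27/28).  Case `dist_∞(x, T ∖ □) ≥ R₀L^k` (`R₀ = 10`, resp. `14`): the deep theorem, constants weakened
monotonically.  Case `T(x, w₀) < R₀L^k` for some `w₀ ∉ □`: then `D_b ≤ T(x,w₀) < R₀L^k`, and for `y ∈ supp f`,
`D_f ≤ T(y, w₀) ≤ T(x, y) + T(x, w₀) < T(x,y) + R₀L^k`, so `D″ = max(D, D_f − R₀L^k)` is an admissible distance for both members at the row
`x`; hence `‖v(x)‖ ≤ 2(L^kε)²c₀e^{−δ₀D″/L^k}F` (resp. `2(L^kε)c₀…` for the derivative), and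
`e^{−δ₀D″/L^k} ≤ e^{R₀δ₀}·e^{−(δ₀/2)D/L^k}·e^{−(δ₀/2)(D_b + D_f)/L^k}` because `D + D_b + D_f ≤ 2D″ + 2R₀L^k` (**`shallow_budget`**).

HONEST SCOPE.  (i) `U(1)` only, `2 ≤ d ≤ 3`, `L` odd `> 1`, `1 ≤ k ≤ K`, block-scale plaquette smallness — as gens 25–28 and p27/p34's members.
(ii) VALUE member: no row restriction left (every `x ∈ □`; `f` supported in `□` as in the consumer shape).  COVARIANT-DERIVATIVE member:
rows whose open `L^k`-ball lies in `□` — the domain on which the (H1.10″)-`D` inputs are stated by their providers (p34's cube/region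
members bound `D_u(G f)` on bonds at depth `≥ L^k`); rows nearer to `∂□` are NOT covered here.  The Hölder member is p27's
`BIJ88NeumannPropagatorSmallFieldCloseHolder` and is not touched.  (iii) For general nested block unions the four members stay
HYPOTHESES (§2–§4); §5 discharges them for (torus cube, whole torus) only — general regions are the sibling file
`BIJ88NeumannPropagatorSmallFieldCloseRegion` (p34's region members).  (iv) The print restricts ALL of (1.9)–(1.12) to `dist(x, Ω^c) ≥ R₀`
for general `Ω` and lifts the restriction for parallelepipeds; our §2 has no restriction for general block unions `□ ⊆ Ω` because our
INPUT members (H1.10″) are assumed on all `□`-rows — where a provider only serves deep rows, the restriction re-enters through the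
hypotheses, not through this file.  (v) Constants explicit, depending on `(d, L, a, c₀, δ₀)` only; no optimisation.  DIVERGENCE OF METHOD
from [7]'s random-walk expansion as disclosed in gens 25–28.  Kernel lemmas tagged [folklore] are real arithmetic.  Nothing here is summit
progress.  Unit `lit-balaban-p30` (literature-prover-lit-balaban-p30-g29-0), HOME `run/shared/lean/pub/lit-balaban/`, 2026-08-23.
-/

open scoped BigOperators ComplexConjugate
open Finset Matrix

namespace Literature.MathematicalPhysics.QuantumFieldTheory.BalabanImbrieJaffe1984to88.BIJ88NeumannPropagatorSmallFieldCloseAllRows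

open Literature.MathematicalPhysics.QuantumFieldTheory.Balaban1983to89
open LatticeFieldCalculus (supDist)
open B3TorusRadialSums (supDist_comm)
open BIJ85Ineq722Torus (supDist_triangle)
open BIJ88Sect3Statements (U1 toC cfg covD norm_toC)
open BIJ85AbelianStokes (plaqC plaqC_eq_toC_plaqHol)
open BIJ88NeumannNoZeroModesTorus (IsBlockUnion isBlockUnion_univ)
open BIJ88NeumannPropagator227Torus (gBox)
open BIJ88NeumannPropagatorFlatDecayCube (cubeT isBlockUnion_cubeT)
open BIJ85ScalarPropagatorSupDecay (decay110_smallField_input)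
open BIJ85ScalarPropagatorSupDecayDeriv (decay110_smallField_deriv)
open BIJ88NeumannPropagatorSmallFieldSupDecay (decay110_smallPlaquette_cube_uniform)
open BIJ88NeumannPropagatorSmallFieldCubeDeriv (decay110_smallPlaquette_cube_deriv_uniform_input)
open BIJ88NeumannPropagatorSmallFieldClose (close112_smallField_of_inputs)
open BIJ88NeumannPropagatorSmallFieldCloseDeriv (close112_smallField_deriv_of_inputs)

noncomputable section

variable {P : Params}

/-! ## §1 Kernel lemmas: monotonicity in the constants, the shallow-row exponent budget, the threshold arithmetic (private) -/

/-- kernel: weakening the constants of a two-factor decay bound, `c ≤ c′`, `δ′ ≤ δ`, `E₁, E₂, F ≥ 0`: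
`c·e^{−δE₁}·e^{−δE₂}·F ≤ c′·e^{−δ′E₁}·e^{−δ′E₂}·F`. [folklore] -/
private theorem mono_bound2 {c c' δ δ' E₁ E₂ F : ℝ} (hc : 0 ≤ c) (hcc : c ≤ c') (hδ : δ' ≤ δ) (hE₁ : 0 ≤ E₁) (hE₂ : 0 ≤ E₂)
    (hF : 0 ≤ F) :
    c * Real.exp (-(δ * E₁)) * Real.exp (-(δ * E₂)) * F ≤ c' * Real.exp (-(δ' * E₁)) * Real.exp (-(δ' * E₂)) * F := by
  have h1 : Real.exp (-(δ * E₁)) ≤ Real.exp (-(δ' * E₁)) := Real.exp_le_exp.2 (neg_le_neg (mul_le_mul_of_nonneg_right hδ hE₁))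
  have h2 : Real.exp (-(δ * E₂)) ≤ Real.exp (-(δ' * E₂)) := Real.exp_le_exp.2 (neg_le_neg (mul_le_mul_of_nonneg_right hδ hE₂))
  have h3 : c * Real.exp (-(δ * E₁)) ≤ c' * Real.exp (-(δ' * E₁)) := mul_le_mul hcc h1 (Real.exp_pos _).le (hc.trans hcc)
  exact mul_le_mul_of_nonneg_right (mul_le_mul h3 h2 (Real.exp_pos _).le (mul_nonneg (hc.trans hcc) (Real.exp_pos _).le)) hF

/-- kernel: weakening the constants of a one-factor decay bound, `c ≤ c′`, `δ′ ≤ δ`, `E, F ≥ 0`: `c·e^{−δE}·F ≤ c′·e^{−δ′E}·F`. [folklore] -/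
private theorem mono_bound {c c' δ δ' E F : ℝ} (hc : 0 ≤ c) (hcc : c ≤ c') (hδ : δ' ≤ δ) (hE : 0 ≤ E) (hF : 0 ≤ F) :
    c * Real.exp (-(δ * E)) * F ≤ c' * Real.exp (-(δ' * E)) * F :=
  mul_le_mul_of_nonneg_right (mul_le_mul hcc (Real.exp_le_exp.2 (neg_le_neg (mul_le_mul_of_nonneg_right hδ hE))) (Real.exp_pos _).le
    (hc.trans hcc)) hF

/-- kernel, **THE SHALLOW-ROW EXPONENT BUDGET**: if `0 ≤ D ≤ D″`, `D_f ≤ D″ + Rn`, `D_b ≤ Rn` (`n = L^k > 0`, `δ₀ ≥ 0`), then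
`e^{−δ₀D″/n} ≤ e^{Rδ₀}·e^{−(δ₀/2)D/n}·e^{−(δ₀/2)(D_b + D_f)/n}` — because `D + D_b + D_f ≤ 2D″ + 2Rn`. [folklore] -/
private theorem shallow_budget {n R δ₀ D D'' Db Df : ℝ} (hn : 0 < n) (hδ₀ : 0 ≤ δ₀) (hDD : D ≤ D'')
    (hDf : Df ≤ D'' + R * n) (hDb : Db ≤ R * n) :
    Real.exp (-(δ₀ * (n⁻¹ * D''))) ≤
      Real.exp (R * δ₀) * Real.exp (-(δ₀ / 2 * (n⁻¹ * D))) * Real.exp (-(δ₀ / 2 * (n⁻¹ * (Db + Df)))) := by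
  rw [← Real.exp_add, ← Real.exp_add]
  refine Real.exp_le_exp.2 ?_
  have hm : 0 ≤ n⁻¹ := (inv_pos.2 hn).le
  have hδ2 : 0 ≤ δ₀ / 2 := by linarith
  have hsum : D + Db + Df ≤ 2 * D'' + 2 * (R * n) := by linarith
  have h1 : δ₀ / 2 * (n⁻¹ * (D + Db + Df)) ≤ δ₀ / 2 * (n⁻¹ * (2 * D'' + 2 * (R * n))) :=
    mul_le_mul_of_nonneg_left (mul_le_mul_of_nonneg_left hsum hm) hδ2
  have hinv : n⁻¹ * n = 1 := inv_mul_cancel₀ hn.ne'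
  have h2 : δ₀ / 2 * (n⁻¹ * (2 * D'' + 2 * (R * n))) = δ₀ * (n⁻¹ * D'') + R * δ₀ := by
    linear_combination (δ₀ * R) * hinv
  have h3 : δ₀ / 2 * (n⁻¹ * (D + Db + Df)) = δ₀ / 2 * (n⁻¹ * D) + δ₀ / 2 * (n⁻¹ * (Db + Df)) := by ring
  linarith

/-- kernel (the arithmetic of p31's `BIJ88DeltaLocSmallPlaquetteTorusCwt.smallness_of_threshold` — the statement of record — repeated
PRIVATELY to keep this propagator-level file below the (2.30)–(2.41) chain in the import order, as in gen 28): the block-scale plaquette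
threshold `(L^{2k}θ)² ≤ 1/500` implies, for `1 ≤ d′ ≤ 3`, `2d′³(L^{2k}θ)² ≤ 1` and, with `T = (d′−1)(L^k−1)θ`,
`2(L^k−1)L^k·d′·T² + 2(d′(L^k−1)T)² ≤ ½`. [cite: BalabanImbrieJaffe1985, (7.3.1) p.326] -/
private theorem threshold_smallness {dr n θ : ℝ} (hd1 : 1 ≤ dr) (hd3 : dr ≤ 3) (hn : 1 ≤ n) (hθ : 0 ≤ θ)
    (hτ : (n ^ 2 * θ) ^ 2 ≤ 1 / 500) :
    2 * dr ^ 3 * (n ^ 2 * θ) ^ 2 ≤ 1 ∧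
      2 * ((n - 1) * n) * dr * ((dr - 1) * (n - 1) * θ) ^ 2 + 2 * (dr * (n - 1) * ((dr - 1) * (n - 1) * θ)) ^ 2 ≤ 1 / 2 := by
  have hd0 : 0 ≤ dr := by linarith
  have hn0 : 0 ≤ n := by linarith
  have hd27 : dr ^ 3 ≤ 27 := by
    have h := pow_le_pow_left₀ hd0 hd3 3
    norm_num at h
    exact h
  have hd81 : dr ^ 4 ≤ 81 := by
    have h := pow_le_pow_left₀ hd0 hd3 4
    norm_num at h
    exact h
  have hτ0 : 0 ≤ (n ^ 2 * θ) ^ 2 := sq_nonneg _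
  refine ⟨?_, ?_⟩
  · calc 2 * dr ^ 3 * (n ^ 2 * θ) ^ 2 ≤ 2 * 27 * (1 / 500) :=
          mul_le_mul (mul_le_mul_of_nonneg_left hd27 (by norm_num)) hτ hτ0 (by norm_num)
      _ ≤ 1 := by norm_num
  · have hn1 : n - 1 ≤ n := by linarith
    have hdr1 : dr - 1 ≤ dr := by linarith
    have hn10 : 0 ≤ n - 1 := by linarith
    have hdr10 : 0 ≤ dr - 1 := by linarith
    calc 2 * ((n - 1) * n) * dr * ((dr - 1) * (n - 1) * θ) ^ 2 + 2 * (dr * (n - 1) * ((dr - 1) * (n - 1) * θ)) ^ 2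
        ≤ 2 * (n * n) * dr * (dr * n * θ) ^ 2 + 2 * (dr * n * (dr * n * θ)) ^ 2 := by gcongr
      _ = (2 * dr ^ 3 + 2 * dr ^ 4) * (n ^ 2 * θ) ^ 2 := by ring
      _ ≤ (2 * 27 + 2 * 81) * (1 / 500) := mul_le_mul (by linarith) hτ hτ0 (by norm_num)
      _ ≤ 1 / 2 := by norm_num

/-- kernel, **THE ADMISSIBLE DISTANCE AT A SHALLOW ROW**: if `w₀ ∉ □` with `T(x, w₀) < Rn` and `D ≤ T(x,y)`, `D_f ≤ T(y,w)` for all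
`y ∈ supp f`, `w ∉ □`, then `D″ = max(D, D_f − Rn) ≤ T(x, y)` for every `y ∈ supp f` (torus triangle inequality).
[cite: Balaban1983RegularityDecay, Theorem p.573 (1.12)] -/
theorem adm_dist_of_shallow {B : Finset (Balaban1983to89.Site P 0)} {x w₀ : Balaban1983to89.Site P 0} (hw₀ : w₀ ∉ B) {Rn D Df : ℝ}
    (hlt : B5Ineq137Torus.T P 0 x w₀ < Rn) {f : Balaban1983to89.Site P 0 → ℂ} (hsD : ∀ y, f y ≠ 0 → D ≤ B5Ineq137Torus.T P 0 x y)
    (hsDf : ∀ y, f y ≠ 0 → ∀ w, w ∉ B → Df ≤ B5Ineq137Torus.T P 0 y w) :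
    ∀ y, f y ≠ 0 → max D (Df - Rn) ≤ B5Ineq137Torus.T P 0 x y := by
  intro y hy
  refine max_le (hsD y hy) ?_
  have h1 := hsDf y hy w₀ hw₀
  have h2 : B5Ineq137Torus.T P 0 y w₀ ≤ B5Ineq137Torus.T P 0 x y + B5Ineq137Torus.T P 0 x w₀ := by
    rw [B3Bound323ZeroTorus.T_eq_supDist, B3Bound323ZeroTorus.T_eq_supDist, B3Bound323ZeroTorus.T_eq_supDist, supDist_comm x y]
    exact_mod_cast supDist_triangle y x w₀
  linarith

section Main

/-! ## §2 The value member at every row of `□` -/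

/-- **[Balaban1983RegularityDecay] THEOREM p. 573, (1.11)–(1.12) — THE `δG_k(□, Ω)` VALUE MEMBER AT SMALL NON-FLAT `U(1)` FIELDS, UNIFORMLY
IN `k`, AT EVERY ROW `x ∈ □`** (gen 27's `close112_smallField_of_inputs` with the row-depth hypothesis removed).  For `2 ≤ d ≤ 3`, `L` odd
`> 1`, `a > 0`, `c₀ ≥ 0`, `δ₀ > 0` there are `c₁, δ₁ > 0` (depending on these only) such that: for every volume, every `1 ≤ k ≤ K`, every
`U(1)` field `u` with `|u(∂p) − 1| ≤ θ`, `2d³(L^{2k}θ)² ≤ 1`, all `k`-block unions `□ ⊆ Ω` such that on the rows `x ∈ □` both `G_k(□,u)` and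
`G_k(Ω,u)` satisfy the (H1.10″) value bound with `(c₀, δ₀)` (HYPOTHESES), EVERY row `x ∈ □`, and every `f` supported in `□` with
`‖f‖_∞ ≤ F`, `D ≤ dist(x, supp f)`, `D_b ≤ dist(x, □^c)`, `D_f ≤ dist(supp f, □^c)` (all `≥ 0`):
`‖(G_k(□,u)f)(x) − (G_k(Ω,u)f)(x)‖ ≤ (L^kε)²·c₁e^{−δ₁D/L^k}·e^{−δ₁(D_b + D_f)/L^k}·F`.  Verbatim (p. 573): *"we have the inequalities (1.5)
and (1.6) (with the same restrictions on x, x′) with the additional factor (1.12) on the right hand sides. For some simple sets Ω, e.g. for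
rectangular parallelepipeds, the inequalities hold without any restrictions on the points x, x′"*.
[cite: Balaban1983RegularityDecay, Theorem p.573 (1.11)–(1.12)] [cite: BalabanImbrieJaffe1985, (7.3.1) p.326] -/
theorem close112_smallField_of_inputs_allRows (d L : ℕ) (hd : 2 ≤ d) (hd3 : d ≤ 3) (hL : Odd L ∧ 1 < L) {a : ℝ} (ha : 0 < a)
    {c₀ δ₀ : ℝ} (hc₀ : 0 ≤ c₀) (hδ₀ : 0 < δ₀) :
    ∃ c₁ δ₁ : ℝ, 0 < c₁ ∧ 0 < δ₁ ∧ ∀ (P : Params), P.d = d → P.L = L → ∀ k : ℕ, 1 ≤ k → k ≤ P.K →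
      ∀ (U : GaugeField P 0 U1) (θ : ℝ), (∀ (y : Balaban1983to89.Site P 0) (μ ν : Fin P.d), ‖plaqC U y μ ν - 1‖ ≤ θ) →
      2 * (P.d : ℝ) ^ 3 * (((P.L : ℝ) ^ k) ^ 2 * θ) ^ 2 ≤ 1 →
      ∀ (B Ω : Finset (Balaban1983to89.Site P 0)), IsBlockUnion k B → IsBlockUnion k Ω → B ⊆ Ω →
      (∀ x ∈ B, ∀ (f : Balaban1983to89.Site P 0 → ℂ) (F D : ℝ), (∀ y, ‖f y‖ ≤ F) → 0 ≤ D →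
          (∀ y, f y ≠ 0 → D ≤ B5Ineq137Torus.T P 0 x y) →
          ‖(gBox (B1RG242Torus.α P a k * (P.L : ℝ) ^ (k * P.d)) P.eps⁻¹ U k B *ᵥ f) x‖ ≤
            P.spacing k ^ 2 * (c₀ * Real.exp (-(δ₀ * (((P.L : ℝ) ^ k)⁻¹ * D))) * F)) →
      (∀ x ∈ B, ∀ (f : Balaban1983to89.Site P 0 → ℂ) (F D : ℝ), (∀ y, ‖f y‖ ≤ F) → 0 ≤ D →
          (∀ y, f y ≠ 0 → D ≤ B5Ineq137Torus.T P 0 x y) →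
          ‖(gBox (B1RG242Torus.α P a k * (P.L : ℝ) ^ (k * P.d)) P.eps⁻¹ U k Ω *ᵥ f) x‖ ≤
            P.spacing k ^ 2 * (c₀ * Real.exp (-(δ₀ * (((P.L : ℝ) ^ k)⁻¹ * D))) * F)) →
      ∀ x ∈ B, ∀ (f : Balaban1983to89.Site P 0 → ℂ) (F D Db Df : ℝ), (∀ y, ‖f y‖ ≤ F) → (∀ y, y ∉ B → f y = 0) →
        0 ≤ D → (∀ y, f y ≠ 0 → D ≤ B5Ineq137Torus.T P 0 x y) → 0 ≤ Db → (∀ w, w ∉ B → Db ≤ B5Ineq137Torus.T P 0 x w) →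
        0 ≤ Df → (∀ y, f y ≠ 0 → ∀ w, w ∉ B → Df ≤ B5Ineq137Torus.T P 0 y w) →
        ‖(gBox (B1RG242Torus.α P a k * (P.L : ℝ) ^ (k * P.d)) P.eps⁻¹ U k B *ᵥ f) x -
            (gBox (B1RG242Torus.α P a k * (P.L : ℝ) ^ (k * P.d)) P.eps⁻¹ U k Ω *ᵥ f) x‖ ≤
          P.spacing k ^ 2 * (c₁ * Real.exp (-(δ₁ * (((P.L : ℝ) ^ k)⁻¹ * D))) *
            Real.exp (-(δ₁ * (((P.L : ℝ) ^ k)⁻¹ * (Db + Df)))) * F) := by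
  obtain ⟨c₁, δ₁, hc₁, hδ₁, H⟩ := close112_smallField_of_inputs d L hd hd3 hL ha hc₀ hδ₀
  refine ⟨max c₁ (2 * c₀ * Real.exp (10 * δ₀)), min δ₁ (δ₀ / 2), lt_max_of_lt_left hc₁, lt_min hδ₁ (half_pos hδ₀), ?_⟩
  intro P hPd hPL k hk1 hkK U θ hθ hsmall B Ω hB hΩ hsub hGB hGΩ x hx f F D Db Df hF hfB hD hsD hDb hsDb hDf hsDf
  have hPk : (0 : ℝ) < (P.L : ℝ) ^ k := pow_pos P.cast_L_pos k
  have hF0 : 0 ≤ F := (norm_nonneg _).trans (hF x)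
  have hsk2 : 0 ≤ P.spacing k ^ 2 := sq_nonneg _
  have hE1 : 0 ≤ ((P.L : ℝ) ^ k)⁻¹ * D := mul_nonneg (inv_pos.2 hPk).le hD
  have hE2 : 0 ≤ ((P.L : ℝ) ^ k)⁻¹ * (Db + Df) := mul_nonneg (inv_pos.2 hPk).le (add_nonneg hDb hDf)
  by_cases hdeep : ∀ w, w ∉ B → 10 * (P.L : ℝ) ^ k ≤ B5Ineq137Torus.T P 0 x w
  · -- deep row: gen 27's theorem with the constants weakened
    refine (H P hPd hPL k hk1 hkK U θ hθ hsmall B Ω hB hΩ hsub hGB hGΩ x hx hdeep f F D Db Df hF hfB hD hsD hDb hsDb hDf hsDf).trans ?_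
    exact mul_le_mul_of_nonneg_left (mono_bound2 hc₁.le (le_max_left _ _) (min_le_left _ _) hE1 hE2 hF0) hsk2
  · -- shallow row: the two value members at the admissible distance `D″ = max(D, D_f − 10L^k)`
    push Not at hdeep
    obtain ⟨w₀, hw₀, hlt⟩ := hdeep
    have hD'' : 0 ≤ max D (Df - 10 * (P.L : ℝ) ^ k) := hD.trans (le_max_left _ _)
    have hsD'' := adm_dist_of_shallow hw₀ hlt hsD hsDf
    have hB1 := hGB x hx f F _ hF hD'' hsD''
    have hΩ1 := hGΩ x hx f F _ hF hD'' hsD''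
    have hDb' : Db ≤ 10 * (P.L : ℝ) ^ k := (hsDb w₀ hw₀).trans hlt.le
    have hDf' : Df ≤ max D (Df - 10 * (P.L : ℝ) ^ k) + 10 * (P.L : ℝ) ^ k := by
      have := le_max_right D (Df - 10 * (P.L : ℝ) ^ k); linarith
    have hbud := shallow_budget (D := D) (R := 10) hPk hδ₀.le (le_max_left _ _) hDf' hDb'
    calc ‖(gBox (B1RG242Torus.α P a k * (P.L : ℝ) ^ (k * P.d)) P.eps⁻¹ U k B *ᵥ f) x -
            (gBox (B1RG242Torus.α P a k * (P.L : ℝ) ^ (k * P.d)) P.eps⁻¹ U k Ω *ᵥ f) x‖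
        ≤ ‖(gBox (B1RG242Torus.α P a k * (P.L : ℝ) ^ (k * P.d)) P.eps⁻¹ U k B *ᵥ f) x‖ +
            ‖(gBox (B1RG242Torus.α P a k * (P.L : ℝ) ^ (k * P.d)) P.eps⁻¹ U k Ω *ᵥ f) x‖ := norm_sub_le _ _
      _ ≤ P.spacing k ^ 2 * (c₀ * Real.exp (-(δ₀ * (((P.L : ℝ) ^ k)⁻¹ * max D (Df - 10 * (P.L : ℝ) ^ k)))) * F) +
            P.spacing k ^ 2 * (c₀ * Real.exp (-(δ₀ * (((P.L : ℝ) ^ k)⁻¹ * max D (Df - 10 * (P.L : ℝ) ^ k)))) * F) :=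
          add_le_add hB1 hΩ1
      _ = P.spacing k ^ 2 * (2 * c₀ * Real.exp (-(δ₀ * (((P.L : ℝ) ^ k)⁻¹ * max D (Df - 10 * (P.L : ℝ) ^ k)))) * F) := by ring
      _ ≤ P.spacing k ^ 2 * (2 * c₀ * Real.exp (10 * δ₀) * Real.exp (-(δ₀ / 2 * (((P.L : ℝ) ^ k)⁻¹ * D))) *
            Real.exp (-(δ₀ / 2 * (((P.L : ℝ) ^ k)⁻¹ * (Db + Df)))) * F) := by
          refine mul_le_mul_of_nonneg_left ?_ hsk2
          have h2c : 0 ≤ 2 * c₀ := by positivity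
          calc 2 * c₀ * Real.exp (-(δ₀ * (((P.L : ℝ) ^ k)⁻¹ * max D (Df - 10 * (P.L : ℝ) ^ k)))) * F
              ≤ 2 * c₀ * (Real.exp (10 * δ₀) * Real.exp (-(δ₀ / 2 * (((P.L : ℝ) ^ k)⁻¹ * D))) *
                  Real.exp (-(δ₀ / 2 * (((P.L : ℝ) ^ k)⁻¹ * (Db + Df))))) * F :=
                mul_le_mul_of_nonneg_right (mul_le_mul_of_nonneg_left hbud h2c) hF0
            _ = _ := by ring
      _ ≤ P.spacing k ^ 2 * (max c₁ (2 * c₀ * Real.exp (10 * δ₀)) * Real.exp (-(min δ₁ (δ₀ / 2) * (((P.L : ℝ) ^ k)⁻¹ * D))) *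
            Real.exp (-(min δ₁ (δ₀ / 2) * (((P.L : ℝ) ^ k)⁻¹ * (Db + Df)))) * F) :=
          mul_le_mul_of_nonneg_left (mono_bound2 (by positivity) (le_max_right _ _) (min_le_right _ _) hE1 hE2 hF0) hsk2

/-! ## §3 The covariant-derivative member at every row whose open `L^k`-ball lies in `□` -/

/-- **[Balaban1983RegularityDecay] THEOREM p. 573, (1.11)–(1.12) — THE `δG_k(□, Ω)` COVARIANT-DERIVATIVE MEMBER AT SMALL NON-FLAT `U(1)`
FIELDS, UNIFORMLY IN `k`, AT EVERY ROW WHOSE OPEN `L^k`-BALL LIES IN `□`** (gen 28's `close112_smallField_deriv_of_inputs` with the row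
hypothesis `14L^k ≤ T x w` weakened to `L^k ≤ T x w`).  For `2 ≤ d ≤ 3`, `L` odd `> 1`, `a > 0`, `c₀ ≥ 0`, `δ₀ > 0` there are `c₂, δ₂ > 0`
(depending on these only) such that: for every volume, every `1 ≤ k ≤ K`, every `U(1)` field with `|u(∂p) − 1| ≤ θ`, `2d³(L^{2k}θ)² ≤ 1`,
all nested `k`-block unions `□ ⊆ Ω` carrying the two (H1.10″) VALUE members on `□`-rows and the two (H1.10″)-`D` members on the rows `x`
with `{T(x,·) < L^k} ⊆ □`, all four with `(c₀, δ₀)` (HYPOTHESES), every row `x ∈ □` with `L^k ≤ T(x, w)` for all `w ∉ □`, every `f`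
supported in `□` (`‖f‖_∞ ≤ F`, `D`, `D_b`, `D_f` as in §2) and every direction `μ`:
`‖covD ε⁻¹ u (G_k(□,u)f) ⟨x,μ⟩ − covD ε⁻¹ u (G_k(Ω,u)f) ⟨x,μ⟩‖ ≤ (L^kε)·c₂e^{−δ₂D/L^k}·e^{−δ₂(D_b + D_f)/L^k}·F`.
[cite: Balaban1983RegularityDecay, Theorem p.573 (1.10)–(1.12)] [cite: BalabanImbrieJaffe1985, (7.3.1) p.326] -/
theorem close112_smallField_deriv_of_inputs_ballRows (d L : ℕ) (hd : 2 ≤ d) (hd3 : d ≤ 3) (hL : Odd L ∧ 1 < L) {a : ℝ} (ha : 0 < a)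
    {c₀ δ₀ : ℝ} (hc₀ : 0 ≤ c₀) (hδ₀ : 0 < δ₀) :
    ∃ c₂ δ₂ : ℝ, 0 < c₂ ∧ 0 < δ₂ ∧ ∀ (P : Params), P.d = d → P.L = L → ∀ k : ℕ, 1 ≤ k → k ≤ P.K →
      ∀ (U : GaugeField P 0 U1) (θ : ℝ), (∀ (y : Balaban1983to89.Site P 0) (μ ν : Fin P.d), ‖plaqC U y μ ν - 1‖ ≤ θ) →
      2 * (P.d : ℝ) ^ 3 * (((P.L : ℝ) ^ k) ^ 2 * θ) ^ 2 ≤ 1 →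
      ∀ (B Ω : Finset (Balaban1983to89.Site P 0)), IsBlockUnion k B → IsBlockUnion k Ω → B ⊆ Ω →
      (∀ x ∈ B, ∀ (f : Balaban1983to89.Site P 0 → ℂ) (F D : ℝ), (∀ y, ‖f y‖ ≤ F) → 0 ≤ D →
          (∀ y, f y ≠ 0 → D ≤ B5Ineq137Torus.T P 0 x y) →
          ‖(gBox (B1RG242Torus.α P a k * (P.L : ℝ) ^ (k * P.d)) P.eps⁻¹ U k B *ᵥ f) x‖ ≤
            P.spacing k ^ 2 * (c₀ * Real.exp (-(δ₀ * (((P.L : ℝ) ^ k)⁻¹ * D))) * F)) →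
      (∀ x ∈ B, ∀ (f : Balaban1983to89.Site P 0 → ℂ) (F D : ℝ), (∀ y, ‖f y‖ ≤ F) → 0 ≤ D →
          (∀ y, f y ≠ 0 → D ≤ B5Ineq137Torus.T P 0 x y) →
          ‖(gBox (B1RG242Torus.α P a k * (P.L : ℝ) ^ (k * P.d)) P.eps⁻¹ U k Ω *ᵥ f) x‖ ≤
            P.spacing k ^ 2 * (c₀ * Real.exp (-(δ₀ * (((P.L : ℝ) ^ k)⁻¹ * D))) * F)) →
      (∀ x, (∀ y, B5Ineq137Torus.T P 0 x y < (P.L : ℝ) ^ k → y ∈ B) →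
          ∀ (f : Balaban1983to89.Site P 0 → ℂ) (F D : ℝ), (∀ y, ‖f y‖ ≤ F) → 0 ≤ D →
          (∀ y, f y ≠ 0 → D ≤ B5Ineq137Torus.T P 0 x y) → ∀ (μ : Fin P.d),
          ‖covD P.eps⁻¹ (cfg U) (gBox (B1RG242Torus.α P a k * (P.L : ℝ) ^ (k * P.d)) P.eps⁻¹ U k B *ᵥ f) ⟨x, μ⟩‖ ≤
            P.spacing k * (c₀ * Real.exp (-(δ₀ * (((P.L : ℝ) ^ k)⁻¹ * D))) * F)) →
      (∀ x, (∀ y, B5Ineq137Torus.T P 0 x y < (P.L : ℝ) ^ k → y ∈ B) →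
          ∀ (f : Balaban1983to89.Site P 0 → ℂ) (F D : ℝ), (∀ y, ‖f y‖ ≤ F) → 0 ≤ D →
          (∀ y, f y ≠ 0 → D ≤ B5Ineq137Torus.T P 0 x y) → ∀ (μ : Fin P.d),
          ‖covD P.eps⁻¹ (cfg U) (gBox (B1RG242Torus.α P a k * (P.L : ℝ) ^ (k * P.d)) P.eps⁻¹ U k Ω *ᵥ f) ⟨x, μ⟩‖ ≤
            P.spacing k * (c₀ * Real.exp (-(δ₀ * (((P.L : ℝ) ^ k)⁻¹ * D))) * F)) →
      ∀ x ∈ B, (∀ w, w ∉ B → (P.L : ℝ) ^ k ≤ B5Ineq137Torus.T P 0 x w) →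
      ∀ (f : Balaban1983to89.Site P 0 → ℂ) (F D Db Df : ℝ), (∀ y, ‖f y‖ ≤ F) → (∀ y, y ∉ B → f y = 0) →
        0 ≤ D → (∀ y, f y ≠ 0 → D ≤ B5Ineq137Torus.T P 0 x y) → 0 ≤ Db → (∀ w, w ∉ B → Db ≤ B5Ineq137Torus.T P 0 x w) →
        0 ≤ Df → (∀ y, f y ≠ 0 → ∀ w, w ∉ B → Df ≤ B5Ineq137Torus.T P 0 y w) → ∀ (μ : Fin P.d),
        ‖covD P.eps⁻¹ (cfg U) (gBox (B1RG242Torus.α P a k * (P.L : ℝ) ^ (k * P.d)) P.eps⁻¹ U k B *ᵥ f) ⟨x, μ⟩ -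
            covD P.eps⁻¹ (cfg U) (gBox (B1RG242Torus.α P a k * (P.L : ℝ) ^ (k * P.d)) P.eps⁻¹ U k Ω *ᵥ f) ⟨x, μ⟩‖ ≤
          P.spacing k * (c₂ * Real.exp (-(δ₂ * (((P.L : ℝ) ^ k)⁻¹ * D))) *
            Real.exp (-(δ₂ * (((P.L : ℝ) ^ k)⁻¹ * (Db + Df)))) * F) := by
  obtain ⟨c₂, δ₂, hc₂, hδ₂, H⟩ := close112_smallField_deriv_of_inputs d L hd hd3 hL ha hc₀ hδ₀
  refine ⟨max c₂ (2 * c₀ * Real.exp (14 * δ₀)), min δ₂ (δ₀ / 2), lt_max_of_lt_left hc₂, lt_min hδ₂ (half_pos hδ₀), ?_⟩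
  intro P hPd hPL k hk1 hkK U θ hθ hsmall B Ω hB hΩ hsub hGB hGΩ hDB hDΩ x hx hrow f F D Db Df hF hfB hD hsD hDb hsDb hDf hsDf μ
  have hPk : (0 : ℝ) < (P.L : ℝ) ^ k := pow_pos P.cast_L_pos k
  have hF0 : 0 ≤ F := (norm_nonneg _).trans (hF x)
  have hsk : 0 ≤ P.spacing k := (P.spacing_pos k).le
  have hE1 : 0 ≤ ((P.L : ℝ) ^ k)⁻¹ * D := mul_nonneg (inv_pos.2 hPk).le hD
  have hE2 : 0 ≤ ((P.L : ℝ) ^ k)⁻¹ * (Db + Df) := mul_nonneg (inv_pos.2 hPk).le (add_nonneg hDb hDf)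
  -- the open `L^k`-ball around `x` lies in `□`
  have hball : ∀ y, B5Ineq137Torus.T P 0 x y < (P.L : ℝ) ^ k → y ∈ B := by
    intro y hy
    by_contra hyB
    exact absurd (hrow y hyB) (not_le.2 hy)
  by_cases hdeep : ∀ w, w ∉ B → 14 * (P.L : ℝ) ^ k ≤ B5Ineq137Torus.T P 0 x w
  · -- deep row: gen 28's theorem with the constants weakened
    refine (H P hPd hPL k hk1 hkK U θ hθ hsmall B Ω hB hΩ hsub hGB hGΩ hDB hDΩ x hx hdeep f F D Db Df hF hfB hD hsD hDb hsDb hDf hsDf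
      μ).trans ?_
    exact mul_le_mul_of_nonneg_left (mono_bound2 hc₂.le (le_max_left _ _) (min_le_left _ _) hE1 hE2 hF0) hsk
  · -- shallow row: the two covariant-derivative members at the admissible distance `D″ = max(D, D_f − 14L^k)`
    push Not at hdeep
    obtain ⟨w₀, hw₀, hlt⟩ := hdeep
    have hD'' : 0 ≤ max D (Df - 14 * (P.L : ℝ) ^ k) := hD.trans (le_max_left _ _)
    have hsD'' := adm_dist_of_shallow hw₀ hlt hsD hsDf
    have hB1 := hDB x hball f F _ hF hD'' hsD'' μ
    have hΩ1 := hDΩ x hball f F _ hF hD'' hsD'' μ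
    have hDb' : Db ≤ 14 * (P.L : ℝ) ^ k := (hsDb w₀ hw₀).trans hlt.le
    have hDf' : Df ≤ max D (Df - 14 * (P.L : ℝ) ^ k) + 14 * (P.L : ℝ) ^ k := by
      have := le_max_right D (Df - 14 * (P.L : ℝ) ^ k); linarith
    have hbud := shallow_budget (D := D) (R := 14) hPk hδ₀.le (le_max_left _ _) hDf' hDb'
    calc ‖covD P.eps⁻¹ (cfg U) (gBox (B1RG242Torus.α P a k * (P.L : ℝ) ^ (k * P.d)) P.eps⁻¹ U k B *ᵥ f) ⟨x, μ⟩ -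
            covD P.eps⁻¹ (cfg U) (gBox (B1RG242Torus.α P a k * (P.L : ℝ) ^ (k * P.d)) P.eps⁻¹ U k Ω *ᵥ f) ⟨x, μ⟩‖
        ≤ ‖covD P.eps⁻¹ (cfg U) (gBox (B1RG242Torus.α P a k * (P.L : ℝ) ^ (k * P.d)) P.eps⁻¹ U k B *ᵥ f) ⟨x, μ⟩‖ +
            ‖covD P.eps⁻¹ (cfg U) (gBox (B1RG242Torus.α P a k * (P.L : ℝ) ^ (k * P.d)) P.eps⁻¹ U k Ω *ᵥ f) ⟨x, μ⟩‖ :=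
          norm_sub_le _ _
      _ ≤ P.spacing k * (c₀ * Real.exp (-(δ₀ * (((P.L : ℝ) ^ k)⁻¹ * max D (Df - 14 * (P.L : ℝ) ^ k)))) * F) +
            P.spacing k * (c₀ * Real.exp (-(δ₀ * (((P.L : ℝ) ^ k)⁻¹ * max D (Df - 14 * (P.L : ℝ) ^ k)))) * F) :=
          add_le_add hB1 hΩ1
      _ = P.spacing k * (2 * c₀ * Real.exp (-(δ₀ * (((P.L : ℝ) ^ k)⁻¹ * max D (Df - 14 * (P.L : ℝ) ^ k)))) * F) := by ring
      _ ≤ P.spacing k * (2 * c₀ * Real.exp (14 * δ₀) * Real.exp (-(δ₀ / 2 * (((P.L : ℝ) ^ k)⁻¹ * D))) *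
            Real.exp (-(δ₀ / 2 * (((P.L : ℝ) ^ k)⁻¹ * (Db + Df)))) * F) := by
          refine mul_le_mul_of_nonneg_left ?_ hsk
          have h2c : 0 ≤ 2 * c₀ := by positivity
          calc 2 * c₀ * Real.exp (-(δ₀ * (((P.L : ℝ) ^ k)⁻¹ * max D (Df - 14 * (P.L : ℝ) ^ k)))) * F
              ≤ 2 * c₀ * (Real.exp (14 * δ₀) * Real.exp (-(δ₀ / 2 * (((P.L : ℝ) ^ k)⁻¹ * D))) *
                  Real.exp (-(δ₀ / 2 * (((P.L : ℝ) ^ k)⁻¹ * (Db + Df))))) * F :=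
                mul_le_mul_of_nonneg_right (mul_le_mul_of_nonneg_left hbud h2c) hF0
            _ = _ := by ring
      _ ≤ P.spacing k * (max c₂ (2 * c₀ * Real.exp (14 * δ₀)) * Real.exp (-(min δ₂ (δ₀ / 2) * (((P.L : ℝ) ^ k)⁻¹ * D))) *
            Real.exp (-(min δ₂ (δ₀ / 2) * (((P.L : ℝ) ^ k)⁻¹ * (Db + Df)))) * F) :=
          mul_le_mul_of_nonneg_left (mono_bound2 (by positivity) (le_max_right _ _) (min_le_right _ _) hE1 hE2 hF0) hsk

/-! ## §4 The consumer shape `hC` of p31's `opClose231_gen`, row sets = the whole cubes -/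

/-- **THE VALUE MEMBER LITERALLY AS HYPOTHESIS `hC` OF `BIJ88DeltaLocClose235General.opClose231_gen` WITH ROW SETS `X_α := □_α`**: for a
family of `k`-block unions `□_α ⊆ Ω` (the cubes of the (2.27) partition) carrying the (H1.10″) value members of every `G_k(□_α,u)` and of
`G_k(Ω,u)` on the rows of the `□_α`: the (H1.12″) closeness binder with constants `(c₁, δ₁)` at EVERY row `x ∈ □_α` (gen 27's
`close112_smallField_hC` required `X_α ⊆ {x ∈ □_α : dist_∞(x, □_α^c) ≥ 10L^k}`).
[cite: Balaban1983RegularityDecay, Theorem p.573 (1.11)–(1.12)] [cite: BalabanImbrieJaffe1988, (2.31) p.263] -/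
theorem close112_smallField_hC_allRows (d L : ℕ) (hd : 2 ≤ d) (hd3 : d ≤ 3) (hL : Odd L ∧ 1 < L) {a : ℝ} (ha : 0 < a)
    {c₀ δ₀ : ℝ} (hc₀ : 0 ≤ c₀) (hδ₀ : 0 < δ₀) :
    ∃ c₁ δ₁ : ℝ, 0 < c₁ ∧ 0 < δ₁ ∧ ∀ (P : Params), P.d = d → P.L = L → ∀ k : ℕ, 1 ≤ k → k ≤ P.K →
      ∀ (U : GaugeField P 0 U1) (θ : ℝ), (∀ (y : Balaban1983to89.Site P 0) (μ ν : Fin P.d), ‖plaqC U y μ ν - 1‖ ≤ θ) →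
      2 * (P.d : ℝ) ^ 3 * (((P.L : ℝ) ^ k) ^ 2 * θ) ^ 2 ≤ 1 →
      ∀ (Ω : Finset (Balaban1983to89.Site P 0)) {ι : Type*} (cube : ι → Finset (Balaban1983to89.Site P 0)),
      IsBlockUnion k Ω → (∀ α, IsBlockUnion k (cube α)) → (∀ α, cube α ⊆ Ω) →
      (∀ α, ∀ x ∈ cube α, ∀ (f : Balaban1983to89.Site P 0 → ℂ) (F D : ℝ), (∀ y, ‖f y‖ ≤ F) → 0 ≤ D →
          (∀ y, f y ≠ 0 → D ≤ B5Ineq137Torus.T P 0 x y) →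
          ‖(gBox (B1RG242Torus.α P a k * (P.L : ℝ) ^ (k * P.d)) P.eps⁻¹ U k (cube α) *ᵥ f) x‖ ≤
            P.spacing k ^ 2 * (c₀ * Real.exp (-(δ₀ * (((P.L : ℝ) ^ k)⁻¹ * D))) * F)) →
      (∀ α, ∀ x ∈ cube α, ∀ (f : Balaban1983to89.Site P 0 → ℂ) (F D : ℝ), (∀ y, ‖f y‖ ≤ F) → 0 ≤ D →
          (∀ y, f y ≠ 0 → D ≤ B5Ineq137Torus.T P 0 x y) →
          ‖(gBox (B1RG242Torus.α P a k * (P.L : ℝ) ^ (k * P.d)) P.eps⁻¹ U k Ω *ᵥ f) x‖ ≤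
            P.spacing k ^ 2 * (c₀ * Real.exp (-(δ₀ * (((P.L : ℝ) ^ k)⁻¹ * D))) * F)) →
      ∀ α, ∀ x ∈ cube α, ∀ (f : Balaban1983to89.Site P 0 → ℂ) (F D Db Df : ℝ), (∀ y, ‖f y‖ ≤ F) → (∀ y, y ∉ cube α → f y = 0) →
        0 ≤ D → (∀ y, f y ≠ 0 → D ≤ B5Ineq137Torus.T P 0 x y) → 0 ≤ Db → (∀ w, w ∉ cube α → Db ≤ B5Ineq137Torus.T P 0 x w) →
        0 ≤ Df → (∀ y, f y ≠ 0 → ∀ w, w ∉ cube α → Df ≤ B5Ineq137Torus.T P 0 y w) →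
        ‖(gBox (B1RG242Torus.α P a k * (P.L : ℝ) ^ (k * P.d)) P.eps⁻¹ U k (cube α) *ᵥ f) x -
            (gBox (B1RG242Torus.α P a k * (P.L : ℝ) ^ (k * P.d)) P.eps⁻¹ U k Ω *ᵥ f) x‖ ≤
          P.spacing k ^ 2 * (c₁ * Real.exp (-(δ₁ * (((P.L : ℝ) ^ k)⁻¹ * D))) *
            Real.exp (-(δ₁ * (((P.L : ℝ) ^ k)⁻¹ * (Db + Df)))) * F) := by
  obtain ⟨c₁, δ₁, hc₁, hδ₁, h⟩ := close112_smallField_of_inputs_allRows d L hd hd3 hL ha hc₀ hδ₀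
  refine ⟨c₁, δ₁, hc₁, hδ₁, ?_⟩
  intro P hPd hPL k hk1 hkK U θ hθ hsmall Ω ι cube hΩ hcube hsub hGcube hGΩ α x hx
  exact h P hPd hPL k hk1 hkK U θ hθ hsmall (cube α) Ω (hcube α) hΩ (hsub α) (hGcube α) (hGΩ α) x hx

end Main

/-! ## §5 The hypothesis-free instances for (torus cube, whole torus) -/

/-- **[Balaban1983RegularityDecay] (1.11)–(1.12), VALUE MEMBER, FOR A TORUS CUBE AGAINST THE WHOLE TORUS AT A SMALL-PLAQUETTE `U(1)` FIELD,
HYPOTHESIS-FREE, AT EVERY ROW `x ∈ □`** — p. 573: *"For some simple sets Ω, e.g. for rectangular parallelepipeds, the inequalities hold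
without any restrictions on the points x, x′, i.e. for all x, x′ ∈ Ω."* (gen 28's `close112_smallPlaquette_cube_torus` with the row-depth
hypothesis removed; §2 with its two (H1.10″) inputs discharged by p27's `decay110_smallField_input` / `decay110_smallPlaquette_cube_uniform`):
for `1 ≤ d`, `d + 1 ≤ 3`, `ℓ ≥ 1` with `ℓ + 1` odd, `a > 0` there are `c₃, δ₃ > 0` such that for every volume (`P.d = d + 1`, `P.L = ℓ + 1`),
every `1 ≤ k ≤ K` with `2(L^k − 1) + 4 < |T|`, every `u` with `‖u(∂p) − 1‖ ≤ θ`, `0 ≤ θ`, `(L^{2k}θ)² ≤ 1/500`, every cube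
`□ = cubeT (L^k) c (L^kM)` (`M_i ≥ 1`, fitting, `L^kM_i < |T|`), EVERY row `x ∈ □` and every `f` supported in `□`:
`‖(G_k(□,u)f)(x) − (G_k(T,u)f)(x)‖ ≤ (L^kε)²·c₃e^{−δ₃D/L^k}e^{−δ₃(D_b + D_f)/L^k}·F`.
[cite: Balaban1983RegularityDecay, Theorem p.573 (1.11)–(1.12)] [cite: BalabanImbrieJaffe1985, (7.3.1) p.326] -/
theorem close112_smallPlaquette_cube_torus_allRows (d ℓ : ℕ) (hd1 : 1 ≤ d) (hd3 : d + 1 ≤ 3) (hℓ : 1 ≤ ℓ) (hodd : Odd (ℓ + 1)) {a : ℝ}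
    (ha : 0 < a) :
    ∃ c₃ δ₃ : ℝ, 0 < c₃ ∧ 0 < δ₃ ∧ ∀ (P : Params) (hPd : P.d = d + 1), P.L = ℓ + 1 →
      ∀ k : ℕ, 1 ≤ k → k ≤ P.K → 2 * (P.L ^ k - 1) + 4 < P.sitesPerDir 0 →
      ∀ (U : GaugeField P 0 U1) (θ : ℝ), 0 ≤ θ → (∀ (y : Balaban1983to89.Site P 0) (μ ν : Fin P.d), ‖plaqC U y μ ν - 1‖ ≤ θ) →
        (((P.L : ℝ) ^ k) ^ 2 * θ) ^ 2 ≤ 1 / 500 →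
      ∀ (c M : Fin (d + 1) → ℕ), (∀ i, 1 ≤ M i) → (∀ i, c i * P.L ^ k + P.L ^ k * M i ≤ P.sitesPerDir 0) →
        (∀ i, P.L ^ k * M i < P.sitesPerDir 0) →
      ∀ x ∈ cubeT hPd (P.L ^ k) c (fun i => P.L ^ k * M i),
      ∀ (f : Balaban1983to89.Site P 0 → ℂ) (F D Db Df : ℝ), (∀ y, ‖f y‖ ≤ F) →
        (∀ y, y ∉ cubeT hPd (P.L ^ k) c (fun i => P.L ^ k * M i) → f y = 0) →
        0 ≤ D → (∀ y, f y ≠ 0 → D ≤ B5Ineq137Torus.T P 0 x y) → 0 ≤ Db →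
        (∀ w, w ∉ cubeT hPd (P.L ^ k) c (fun i => P.L ^ k * M i) → Db ≤ B5Ineq137Torus.T P 0 x w) →
        0 ≤ Df → (∀ y, f y ≠ 0 → ∀ w, w ∉ cubeT hPd (P.L ^ k) c (fun i => P.L ^ k * M i) → Df ≤ B5Ineq137Torus.T P 0 y w) →
        ‖(gBox (B1RG242Torus.α P a k * (P.L : ℝ) ^ (k * P.d)) P.eps⁻¹ U k (cubeT hPd (P.L ^ k) c fun i => P.L ^ k * M i) *ᵥ f) x -
            (gBox (B1RG242Torus.α P a k * (P.L : ℝ) ^ (k * P.d)) P.eps⁻¹ U k univ *ᵥ f) x‖ ≤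
          P.spacing k ^ 2 * (c₃ * Real.exp (-(δ₃ * (((P.L : ℝ) ^ k)⁻¹ * D))) *
            Real.exp (-(δ₃ * (((P.L : ℝ) ^ k)⁻¹ * (Db + Df)))) * F) := by
  obtain ⟨δa, ca, hδa, hca, HA⟩ := decay110_smallField_input (d + 1) (ℓ + 1) (Nat.succ_pos d) hd3 ⟨hodd, by omega⟩ ha
  obtain ⟨δb, cb, hδb, hcb, HB⟩ := decay110_smallPlaquette_cube_uniform d ℓ hd3 hℓ ha
  obtain ⟨c₁, δ₁, hc₁, hδ₁, HC⟩ := close112_smallField_of_inputs_allRows (d + 1) (ℓ + 1) (by omega) hd3 ⟨hodd, by omega⟩ ha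
    (le_max_of_le_left hca.le : (0 : ℝ) ≤ max ca cb) (lt_min hδa hδb)
  refine ⟨c₁, δ₁, hc₁, hδ₁, ?_⟩
  intro P hPd hPL k hk1 hkK hbig U θ hθ0 hθ hτ c M hM hfit hN x hx f F D Db Df hF hfB hD hsD hDb hsDb hDf hsDf
  have hkm : k ≤ P.m + P.K := hkK.trans (Nat.le_add_left _ _)
  have hLr : (1 : ℝ) ≤ (P.L : ℝ) ^ k := one_le_pow₀ (B1RG242Torus.one_lt_cast_L P).le
  have hPk : (0 : ℝ) < (P.L : ℝ) ^ k := pow_pos P.cast_L_pos k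
  have hdr : (P.d : ℝ) = (d : ℝ) + 1 := by rw [hPd]; push_cast; ring
  have hd1r : (1 : ℝ) ≤ P.d := by rw [hdr]; linarith [(Nat.cast_nonneg d : (0 : ℝ) ≤ d)]
  have hd3r : (P.d : ℝ) ≤ 3 := by rw [hPd]; exact_mod_cast hd3
  obtain ⟨hsm1, hsm2⟩ := threshold_smallness hd1r hd3r hLr hθ0 hτ
  have hsk2 : 0 ≤ P.spacing k ^ 2 := sq_nonneg _
  have hplaq : ∀ p : Balaban1983to89.Plaq P 0, ‖toC (GaugeField.plaqHol U p) - 1‖ ≤ θ := by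
    rintro ⟨y, μ, ν, hμν⟩
    rw [← plaqC_eq_toC_plaqHol U y hμν]; exact hθ y μ ν
  have hT : ((P.d - 1 : ℕ) : ℝ) * ((P.L : ℝ) ^ k - 1) * θ ≤ ((P.d : ℝ) - 1) * ((P.L : ℝ) ^ k - 1) * θ := by
    rw [Nat.cast_sub P.hd, Nat.cast_one]
  -- the two value members at `(max ca cb, min δa δb)`
  have hGB : ∀ x ∈ cubeT hPd (P.L ^ k) c (fun i => P.L ^ k * M i), ∀ (f : Balaban1983to89.Site P 0 → ℂ) (F D : ℝ),
      (∀ y, ‖f y‖ ≤ F) → 0 ≤ D → (∀ y, f y ≠ 0 → D ≤ B5Ineq137Torus.T P 0 x y) →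
      ‖(gBox (B1RG242Torus.α P a k * (P.L : ℝ) ^ (k * P.d)) P.eps⁻¹ U k (cubeT hPd (P.L ^ k) c fun i => P.L ^ k * M i) *ᵥ f) x‖ ≤
        P.spacing k ^ 2 * (max ca cb * Real.exp (-(min δa δb * (((P.L : ℝ) ^ k)⁻¹ * D))) * F) := by
    intro x _ f F D hF hD hsupp
    have hF0 : 0 ≤ F := (norm_nonneg _).trans (hF x)
    refine (HB P hPd hPL k hk1 hkm hbig U θ hθ0 hplaq _ hT hsm2 c M hM hfit hN x f F D hF hsupp).trans ?_
    exact mul_le_mul_of_nonneg_left (mono_bound hcb.le (le_max_right _ _) (min_le_right _ _) (mul_nonneg (inv_pos.2 hPk).le hD) hF0) hsk2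
  have hGΩ : ∀ x ∈ cubeT hPd (P.L ^ k) c (fun i => P.L ^ k * M i), ∀ (f : Balaban1983to89.Site P 0 → ℂ) (F D : ℝ),
      (∀ y, ‖f y‖ ≤ F) → 0 ≤ D → (∀ y, f y ≠ 0 → D ≤ B5Ineq137Torus.T P 0 x y) →
      ‖(gBox (B1RG242Torus.α P a k * (P.L : ℝ) ^ (k * P.d)) P.eps⁻¹ U k univ *ᵥ f) x‖ ≤
        P.spacing k ^ 2 * (max ca cb * Real.exp (-(min δa δb * (((P.L : ℝ) ^ k)⁻¹ * D))) * F) := by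
    intro x _ f F D hF hD hsupp
    have hF0 : 0 ≤ F := (norm_nonneg _).trans (hF x)
    refine (HA P hPd hPL k hk1 hkK U θ hθ hsm1 x f F D hF hsupp).trans ?_
    exact mul_le_mul_of_nonneg_left (mono_bound hca.le (le_max_left _ _) (min_le_left _ _) (mul_nonneg (inv_pos.2 hPk).le hD) hF0) hsk2
  exact HC P hPd hPL k hk1 hkK U θ hθ hsm1 _ univ (isBlockUnion_cubeT hPd hkm rfl hfit) (isBlockUnion_univ k) (subset_univ _) hGB hGΩ x hx
    f F D Db Df hF hfB hD hsD hDb hsDb hDf hsDf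

/-- **[Balaban1983RegularityDecay] (1.11)–(1.12), COVARIANT-DERIVATIVE MEMBER, FOR A TORUS CUBE AGAINST THE WHOLE TORUS AT A SMALL-PLAQUETTE
`U(1)` FIELD, HYPOTHESIS-FREE, AT EVERY ROW WITH `dist_∞(x, T ∖ □) ≥ L^k`** (gen 28's `close112_smallPlaquette_cube_torus_deriv` with
`14L^k` lowered to `L^k`; §3 with its four (H1.10″) inputs discharged by p27's `decay110_smallField_input` /
`decay110_smallPlaquette_cube_uniform` (values), gen 25's `decay110_smallField_deriv` and p34's
`decay110_smallPlaquette_cube_deriv_uniform_input` (covariant derivatives)): same data as the value member, rows `x ∈ □` with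
`L^k ≤ T(x, w)` for every `w ∉ □`, every `μ`:
`‖covD ε⁻¹ u (G_k(□,u)f) ⟨x,μ⟩ − covD ε⁻¹ u (G_k(T,u)f) ⟨x,μ⟩‖ ≤ (L^kε)·c₃e^{−δ₃D/L^k}e^{−δ₃(D_b + D_f)/L^k}·F`.
[cite: Balaban1983RegularityDecay, Theorem p.573 (1.10)–(1.12)] [cite: BalabanImbrieJaffe1985, (7.3.1) p.326] -/
theorem close112_smallPlaquette_cube_torus_deriv_ballRows (d ℓ : ℕ) (hd1 : 1 ≤ d) (hd3 : d + 1 ≤ 3) (hℓ : 1 ≤ ℓ) (hodd : Odd (ℓ + 1))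
    {a : ℝ} (ha : 0 < a) :
    ∃ c₃ δ₃ : ℝ, 0 < c₃ ∧ 0 < δ₃ ∧ ∀ (P : Params) (hPd : P.d = d + 1), P.L = ℓ + 1 →
      ∀ k : ℕ, 1 ≤ k → k ≤ P.K → 2 * (P.L ^ k - 1) + 4 < P.sitesPerDir 0 →
      ∀ (U : GaugeField P 0 U1) (θ : ℝ), 0 ≤ θ → (∀ (y : Balaban1983to89.Site P 0) (μ ν : Fin P.d), ‖plaqC U y μ ν - 1‖ ≤ θ) →
        (((P.L : ℝ) ^ k) ^ 2 * θ) ^ 2 ≤ 1 / 500 →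
      ∀ (c M : Fin (d + 1) → ℕ), (∀ i, 1 ≤ M i) → (∀ i, c i * P.L ^ k + P.L ^ k * M i ≤ P.sitesPerDir 0) →
        (∀ i, P.L ^ k * M i < P.sitesPerDir 0) →
      ∀ x ∈ cubeT hPd (P.L ^ k) c (fun i => P.L ^ k * M i),
        (∀ w, w ∉ cubeT hPd (P.L ^ k) c (fun i => P.L ^ k * M i) → (P.L : ℝ) ^ k ≤ B5Ineq137Torus.T P 0 x w) →
      ∀ (f : Balaban1983to89.Site P 0 → ℂ) (F D Db Df : ℝ), (∀ y, ‖f y‖ ≤ F) →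
        (∀ y, y ∉ cubeT hPd (P.L ^ k) c (fun i => P.L ^ k * M i) → f y = 0) →
        0 ≤ D → (∀ y, f y ≠ 0 → D ≤ B5Ineq137Torus.T P 0 x y) → 0 ≤ Db →
        (∀ w, w ∉ cubeT hPd (P.L ^ k) c (fun i => P.L ^ k * M i) → Db ≤ B5Ineq137Torus.T P 0 x w) →
        0 ≤ Df → (∀ y, f y ≠ 0 → ∀ w, w ∉ cubeT hPd (P.L ^ k) c (fun i => P.L ^ k * M i) → Df ≤ B5Ineq137Torus.T P 0 y w) →
        ∀ (μ : Fin P.d),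
        ‖covD P.eps⁻¹ (cfg U) (gBox (B1RG242Torus.α P a k * (P.L : ℝ) ^ (k * P.d)) P.eps⁻¹ U k
              (cubeT hPd (P.L ^ k) c fun i => P.L ^ k * M i) *ᵥ f) ⟨x, μ⟩ -
            covD P.eps⁻¹ (cfg U) (gBox (B1RG242Torus.α P a k * (P.L : ℝ) ^ (k * P.d)) P.eps⁻¹ U k univ *ᵥ f) ⟨x, μ⟩‖ ≤
          P.spacing k * (c₃ * Real.exp (-(δ₃ * (((P.L : ℝ) ^ k)⁻¹ * D))) *
            Real.exp (-(δ₃ * (((P.L : ℝ) ^ k)⁻¹ * (Db + Df)))) * F) := by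
  obtain ⟨δa, ca, hδa, hca, HA⟩ := decay110_smallField_input (d + 1) (ℓ + 1) (Nat.succ_pos d) hd3 ⟨hodd, by omega⟩ ha
  obtain ⟨δb, cb, hδb, hcb, HB⟩ := decay110_smallPlaquette_cube_uniform d ℓ hd3 hℓ ha
  obtain ⟨tc, cc, htc, hcc, HCd⟩ := decay110_smallField_deriv (d + 1) (ℓ + 1) (by omega) hd3 ⟨hodd, by omega⟩ ha
  obtain ⟨td, cd, htd, hcd, HDd⟩ := decay110_smallPlaquette_cube_deriv_uniform_input d (ℓ + 1) hd1 hd3 ⟨hodd, by omega⟩ ha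
  set c₀ : ℝ := max (max ca cb) (max cc cd) with hc₀def
  set δ₀ : ℝ := min (min δa δb) (min tc td) with hδ₀def
  have hc₀ : 0 ≤ c₀ := hca.le.trans ((le_max_left _ _).trans (le_max_left _ _))
  have hδ₀ : 0 < δ₀ := lt_min (lt_min hδa hδb) (lt_min htc htd)
  have hca' : ca ≤ c₀ := (le_max_left _ _).trans (le_max_left _ _)
  have hcb' : cb ≤ c₀ := (le_max_right _ _).trans (le_max_left _ _)
  have hcc' : cc ≤ c₀ := (le_max_left _ _).trans (le_max_right _ _)
  have hcd' : cd ≤ c₀ := (le_max_right _ _).trans (le_max_right _ _)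
  have hδa' : δ₀ ≤ δa := (min_le_left _ _).trans (min_le_left _ _)
  have hδb' : δ₀ ≤ δb := (min_le_left _ _).trans (min_le_right _ _)
  have htc' : δ₀ ≤ tc := (min_le_right _ _).trans (min_le_left _ _)
  have htd' : δ₀ ≤ td := (min_le_right _ _).trans (min_le_right _ _)
  obtain ⟨c₂, δ₂, hc₂, hδ₂, H⟩ := close112_smallField_deriv_of_inputs_ballRows (d + 1) (ℓ + 1) (by omega) hd3 ⟨hodd, by omega⟩ ha hc₀ hδ₀
  refine ⟨c₂, δ₂, hc₂, hδ₂, ?_⟩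
  intro P hPd hPL k hk1 hkK hbig U θ hθ0 hθ hτ c M hM hfit hN x hx hrow f F D Db Df hF hfB hD hsD hDb hsDb hDf hsDf μ
  have hkm : k ≤ P.m + P.K := hkK.trans (Nat.le_add_left _ _)
  have hLr : (1 : ℝ) ≤ (P.L : ℝ) ^ k := one_le_pow₀ (B1RG242Torus.one_lt_cast_L P).le
  have hPk : (0 : ℝ) < (P.L : ℝ) ^ k := pow_pos P.cast_L_pos k
  have hdr : (P.d : ℝ) = (d : ℝ) + 1 := by rw [hPd]; push_cast; ring
  have hd1r : (1 : ℝ) ≤ P.d := by rw [hdr]; linarith [(Nat.cast_nonneg d : (0 : ℝ) ≤ d)]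
  have hd3r : (P.d : ℝ) ≤ 3 := by rw [hPd]; exact_mod_cast hd3
  obtain ⟨hsm1, hsm2⟩ := threshold_smallness hd1r hd3r hLr hθ0 hτ
  have hsk2 : 0 ≤ P.spacing k ^ 2 := sq_nonneg _
  have hsk : 0 ≤ P.spacing k := (P.spacing_pos k).le
  have hplaq : ∀ p : Balaban1983to89.Plaq P 0, ‖toC (GaugeField.plaqHol U p) - 1‖ ≤ θ := by
    rintro ⟨y, μ, ν, hμν⟩
    rw [← plaqC_eq_toC_plaqHol U y hμν]; exact hθ y μ ν
  have hT : ((P.d - 1 : ℕ) : ℝ) * ((P.L : ℝ) ^ k - 1) * θ ≤ ((P.d : ℝ) - 1) * ((P.L : ℝ) ^ k - 1) * θ := by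
    rw [Nat.cast_sub P.hd, Nat.cast_one]
  -- the two value members at `(c₀, δ₀)`
  have hGB : ∀ x ∈ cubeT hPd (P.L ^ k) c (fun i => P.L ^ k * M i), ∀ (f : Balaban1983to89.Site P 0 → ℂ) (F D : ℝ),
      (∀ y, ‖f y‖ ≤ F) → 0 ≤ D → (∀ y, f y ≠ 0 → D ≤ B5Ineq137Torus.T P 0 x y) →
      ‖(gBox (B1RG242Torus.α P a k * (P.L : ℝ) ^ (k * P.d)) P.eps⁻¹ U k (cubeT hPd (P.L ^ k) c fun i => P.L ^ k * M i) *ᵥ f) x‖ ≤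
        P.spacing k ^ 2 * (c₀ * Real.exp (-(δ₀ * (((P.L : ℝ) ^ k)⁻¹ * D))) * F) := by
    intro x _ f F D hF hD hsupp
    have hF0 : 0 ≤ F := (norm_nonneg _).trans (hF x)
    refine (HB P hPd hPL k hk1 hkm hbig U θ hθ0 hplaq _ hT hsm2 c M hM hfit hN x f F D hF hsupp).trans ?_
    exact mul_le_mul_of_nonneg_left (mono_bound hcb.le hcb' hδb' (mul_nonneg (inv_pos.2 hPk).le hD) hF0) hsk2
  have hGΩ : ∀ x ∈ cubeT hPd (P.L ^ k) c (fun i => P.L ^ k * M i), ∀ (f : Balaban1983to89.Site P 0 → ℂ) (F D : ℝ),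
      (∀ y, ‖f y‖ ≤ F) → 0 ≤ D → (∀ y, f y ≠ 0 → D ≤ B5Ineq137Torus.T P 0 x y) →
      ‖(gBox (B1RG242Torus.α P a k * (P.L : ℝ) ^ (k * P.d)) P.eps⁻¹ U k univ *ᵥ f) x‖ ≤
        P.spacing k ^ 2 * (c₀ * Real.exp (-(δ₀ * (((P.L : ℝ) ^ k)⁻¹ * D))) * F) := by
    intro x _ f F D hF hD hsupp
    have hF0 : 0 ≤ F := (norm_nonneg _).trans (hF x)
    refine (HA P hPd hPL k hk1 hkK U θ hθ hsm1 x f F D hF hsupp).trans ?_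
    exact mul_le_mul_of_nonneg_left (mono_bound hca.le hca' hδa' (mul_nonneg (inv_pos.2 hPk).le hD) hF0) hsk2
  -- the two covariant-derivative members at `(c₀, δ₀)`
  have hDB : ∀ x, (∀ y, B5Ineq137Torus.T P 0 x y < (P.L : ℝ) ^ k → y ∈ cubeT hPd (P.L ^ k) c (fun i => P.L ^ k * M i)) →
      ∀ (f : Balaban1983to89.Site P 0 → ℂ) (F D : ℝ), (∀ y, ‖f y‖ ≤ F) → 0 ≤ D → (∀ y, f y ≠ 0 → D ≤ B5Ineq137Torus.T P 0 x y) →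
      ∀ (μ : Fin P.d), ‖covD P.eps⁻¹ (cfg U) (gBox (B1RG242Torus.α P a k * (P.L : ℝ) ^ (k * P.d)) P.eps⁻¹ U k
          (cubeT hPd (P.L ^ k) c fun i => P.L ^ k * M i) *ᵥ f) ⟨x, μ⟩‖ ≤
        P.spacing k * (c₀ * Real.exp (-(δ₀ * (((P.L : ℝ) ^ k)⁻¹ * D))) * F) := by
    intro x hball f F D hF hD hsupp μ
    have hF0 : 0 ≤ F := (norm_nonneg _).trans (hF x)
    refine (HDd P hPd hPL k hk1 hkK hbig U θ hθ0 hplaq hsm1 _ hT hsm2 c M hM hfit hN x hball f F D hF hsupp μ).trans ?_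
    exact mul_le_mul_of_nonneg_left (mono_bound hcd.le hcd' htd' (mul_nonneg (inv_pos.2 hPk).le hD) hF0) hsk
  have hDΩ : ∀ x, (∀ y, B5Ineq137Torus.T P 0 x y < (P.L : ℝ) ^ k → y ∈ cubeT hPd (P.L ^ k) c (fun i => P.L ^ k * M i)) →
      ∀ (f : Balaban1983to89.Site P 0 → ℂ) (F D : ℝ), (∀ y, ‖f y‖ ≤ F) → 0 ≤ D → (∀ y, f y ≠ 0 → D ≤ B5Ineq137Torus.T P 0 x y) →
      ∀ (μ : Fin P.d), ‖covD P.eps⁻¹ (cfg U) (gBox (B1RG242Torus.α P a k * (P.L : ℝ) ^ (k * P.d)) P.eps⁻¹ U k univ *ᵥ f) ⟨x, μ⟩‖ ≤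
        P.spacing k * (c₀ * Real.exp (-(δ₀ * (((P.L : ℝ) ^ k)⁻¹ * D))) * F) := by
    intro x _ f F D hF hD hsupp μ
    have hF0 : 0 ≤ F := (norm_nonneg _).trans (hF x)
    have h := HCd P hPd hPL k hk1 hkK U θ hθ hsm1 x μ f F D hF
      (fun z hz => by rw [← B3Bound323ZeroTorus.T_eq_supDist]; exact hsupp z hz)
    have e : cc * P.spacing k * Real.exp (-(tc * D / (P.L : ℝ) ^ k)) * F =
        P.spacing k * (cc * Real.exp (-(tc * (((P.L : ℝ) ^ k)⁻¹ * D))) * F) := by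
      rw [show tc * D / (P.L : ℝ) ^ k = tc * (((P.L : ℝ) ^ k)⁻¹ * D) by rw [div_eq_mul_inv]; ring]; ring
    rw [e] at h
    refine h.trans ?_
    exact mul_le_mul_of_nonneg_left (mono_bound hcc.le hcc' htc' (mul_nonneg (inv_pos.2 hPk).le hD) hF0) hsk
  exact H P hPd hPL k hk1 hkK U θ hθ hsm1 _ univ (isBlockUnion_cubeT hPd hkm rfl hfit) (isBlockUnion_univ k) (subset_univ _) hGB hGΩ hDB hDΩ
    x hx hrow f F D Db Df hF hfB hD hsD hDb hsDb hDf hsDf μ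

end

end Literature.MathematicalPhysics.QuantumFieldTheory.BalabanImbrieJaffe1984to88.BIJ88NeumannPropagatorSmallFieldCloseAllRows
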